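import Literature.AlgebraicGeometry.Motives.GaloisThickeningSmoothProper
import Literature.AlgebraicGeometry.Motives.GaloisThickeningProductAction
import Literature.AlgebraicGeometry.Motives.IntegralModelReductionMap            -- ★ `IntegralModel.genericIso'`
import Literature.AlgebraicGeometry.Limits.LocalizationProjectiveSpread           -- ★ PROJ-SPREAD `IntegralModel.eventually_isProjective_localise` (A-p03)
import Literature.AlgebraicGeometry.RelativeSpec.StableAffineOpenOfIsProjective   -- ★ `forall_exists_stableAffineOpen_over_of_isProjective` (B-p18)
import Literature.RingTheory.DedekindDomain.UnitsAtCofinitelyManyPrimes           -- ★ `eventually_isUnit_natCard_valuationSubringAtPrime`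
import HarnessLib

/-!
# The integral package of the Galois thickening at cofinitely many primes (the GEO layer of the P6a letter UP)

Topic `Literature/AlgebraicGeometry/Motives`, namespace `Literature.AlgebraicGeometry.Motives`.  THEOREMS ONLY; no definition, no named fact, no
instance, no notation, no `sorry`.  Cell `hodgecm-mathlib`, P6 «MOD programme», organ «GEO-PKG» for the sub-line
`Cruxes/HLiu418/Lines/F0_P6a_ModuliDatum.lean` ED. 2 (desk F0P6a-plan (g0), census `F0/P6/F0P6a-plan/ED2-CENSUS-P6a.v1.F0P6a-plan-g0.md` §0∕§2: «GEO —
the geometric layer (moduli-FREE; ★-assemblable) … manufactures … the generic data `(Y, π, Γ, τ, _hτπ, _hτT, ℓ, _hℓ)` OUTRIGHT, and — for all but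
finitely many `w` — the integral data `(𝓨 := 𝒳.localise w, h𝓨, θ_w, _hcovθ, _hθ)` and the two unit conditions»).  HC_CM is proved only modulo the
printed citations until rung 0 closes; nothing here is about HC.

THE MATHEMATICS.  Let `F` be a number field, `X` a smooth projective curve over `F` (smooth of relative dimension `1`, projective over `F`),
`G` a finite group acting on `X` by `F`-automorphisms (`ρ : G → Aut_F X`), `Fᵢ ∕ F` a finite Galois extension with group `Γ`, and
`Y := R_{Fᵢ} X = X ⊗_F Fᵢ` regarded over `F` (★ `thickening`), with the product action `τ` of `Γ × G` (★ `thickeningProdAction`).  Let `𝒳` be a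
GLOBAL integral model of `Y` over `𝓞 F` whose structure morphism is quasi-compact, quasi-separated and locally of finite presentation.  Then for ALL
BUT FINITELY MANY primes `w` of `F`:
* `|G|` and `|Γ|` are units of `𝒪_{F,(w)}` ([Neukirch1999] I §11; ★ `eventually_isUnit_natCard_valuationSubringAtPrime`);
* the localised model `𝓨 := 𝒳 ⊗ 𝒪_{F,(w)}` (★ `IntegralModel.localise`, [SerreTate1968] §1) is SMOOTH of relative dimension `1` and PROPER
  ([EGAIV3] 8.10.5, [EGAIV4] 17.7.8 — spreading out, ★ `IntegralModel.eventually_isSmoothProper_localise`, fed by ★ GAL-5: `Y → Spec F` is smooth of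
  relative dimension `1` and proper) and PROJECTIVE over `Spec 𝒪_{F,(w)}` (★ PROJ-SPREAD `IntegralModel.eventually_isProjective_localise`, fed by ★
  `isProjectiveOver_thickening`);
* consequently every action `θ` of a finite group on `𝓨` over `Spec 𝒪_{F,(w)}` has a stable affine cover ([SGA1] V Prop. 1.8; ★
  `forall_exists_stableAffineOpen_over_of_isProjective`), in particular the action `θ_w` extending `τ` whose existence for cofinitely many `w` is
  the letter EQV-SPREAD — taken here as the hypothesis `hEQV` in the literal shape of UP's binder `_hθ` (its proof, [EGAIV3] 8.8.2, is the organ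
  `Limits/LocalizationActionSpread` of A-p03).
Intersecting the five cofinite sets gives `exists_integralPackage_eventually`, whose conclusion lists UP's integral binders
`(_hcard, _hcardΓ, h𝓨, θ, _hcovθ, _hθ)` at `𝓨 := 𝒳.localise w`; the generic binders are ★ by name (`thickeningπ`, `thickeningProdAction`,
`isGeometricQuotient_inl_thickeningProdAction`, `thickeningProdAction_inr_comp_π`, `thickeningLift`, `map_thickeningπ_thickeningLift`).

MAIN STATEMENTS.  `smoothOfRelativeDimension_one_thickening`∕`isProper_thickening`∕`isProjectiveOver_thickening'` (the (Y-SP) inputs from the curve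
data), `eventually_isSmoothProper_localise_thickening`, `eventually_isProjective_localise_thickening`, `eventually_forall_exists_stableAffineOpen`,
**`exists_integralPackage_eventually`** (THE HEAD).

## References
* [SerreTate1968] J.-P. Serre, J. Tate, *Good reduction of abelian varieties*, Ann. of Math. 88 (1968), §1 (models over `𝒪_(v)`).
* [EGAIV3] A. Grothendieck, J. Dieudonné, *EGA IV₃*, Thm. 8.10.5, 8.8.2 (spreading out properties and morphisms).
* [EGAIV4] A. Grothendieck, J. Dieudonné, *EGA IV₄*, 17.7.8 (spreading out smoothness).
* [SGA1] A. Grothendieck, *SGA 1*, Exp. V, Prop. 1.8 (stable affine opens for a finite group on a projective scheme).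
* [Neukirch1999] J. Neukirch, *Algebraic Number Theory*, Ch. I §11 (units at almost all primes).
-/

set_option autoImplicit false

noncomputable section

open CategoryTheory AlgebraicGeometry Limits IsDedekindDomain IsDedekindDomain.HeightOneSpectrum Filter
open scoped NumberField

namespace Literature.AlgebraicGeometry.Motives

open Literature.AlgebraicGeometry.RelativeSpec
open Literature.AlgebraicGeometry.Morphisms
open Literature.NumberTheory.EllipticCurves (genericFibre)

variable {F : Type} [Field F] [NumberField F] {Fi : Type} [Field Fi] [Algebra F Fi] [FiniteDimensional F Fi]

/-! ## §1 The thickened curve `Y = R_{Fᵢ} X` is a smooth projective curve over `F` -/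

omit [NumberField F] in
/-- `Y = R_{Fᵢ} X → Spec F` is smooth of relative dimension `1` when `X → Spec F` is (`Fᵢ ∕ F` separable). [cite: EGAIV4, 17.3.3 (iii) and 17.10.2] -/
theorem smoothOfRelativeDimension_one_thickening [Algebra.IsSeparable F Fi] (X : SchemeOver F) [SmoothOfRelativeDimension 1 X.hom] :
    SmoothOfRelativeDimension 1 ((thickening F Fi).obj X).hom :=
  smoothOfRelativeDimension_thickening_hom X

omit [NumberField F] in
/-- `Y = R_{Fᵢ} X → Spec F` is proper when `X` is projective over `F`. [cite: GortzWedhorn2020, Prop. 12.58] -/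
theorem isProper_thickening (X : SchemeOver F) (hX : IsProjectiveOver X) : IsProper ((thickening F Fi).obj X).hom :=
  haveI : IsProper X.hom := (IsProjective.of_isProjectiveOver hX).isProper
  isProper_thickening_hom X

/-! ## §2 Cofinitely in `w`: the localised model is smooth, proper, projective, with stable affine covers -/

variable {X : SchemeOver F} (𝒳 : IntegralModel (𝓞 F) F ((thickening F Fi).obj X))
  [QuasiCompact 𝒳.total.hom] [QuasiSeparated 𝒳.total.hom] [LocallyOfFinitePresentation 𝒳.total.hom]

/-- **`h𝓨` cofinitely**: a finitely presented global model of `Y = R_{Fᵢ} X` (`X` a smooth projective curve over `F`, `Fᵢ ∕ F` separable) is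
smooth of relative dimension `1` and proper at all but finitely many `w`. [cite: EGAIV4, 17.7.8 (ii)] [cite: EGAIV3, Thm. 8.10.5 (xii)] -/
theorem eventually_isSmoothProper_localise_thickening [Algebra.IsSeparable F Fi] [SmoothOfRelativeDimension 1 X.hom]
    (hX : IsProjectiveOver X) : ∀ᶠ w : HeightOneSpectrum (𝓞 F) in cofinite, (𝒳.localise w).IsSmoothProper 1 :=
  haveI := isProper_thickening (Fi := Fi) X hX
  𝒳.eventually_isSmoothProper_localise (smoothOfRelativeDimension_one_thickening (Fi := Fi) X) inferInstance

/-- **Projectivity cofinitely**: the localised model of `Y = R_{Fᵢ} X` is projective over `Spec 𝒪_{F,(w)}` at all but finitely many `w`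
(★ PROJ-SPREAD fed by ★ `isProjectiveOver_thickening`). [cite: EGAIV3, Thm. 8.10.5 (xiii)] -/
theorem eventually_isProjective_localise_thickening (hX : IsProjectiveOver X) :
    ∀ᶠ w : HeightOneSpectrum (𝓞 F) in cofinite, IsProjective (𝒳.localise w).total.hom :=
  Limits.IntegralModel.eventually_isProjective_localise 𝒳 (isProjectiveOver_thickening X hX)

/-- **`_hcovθ` cofinitely, for EVERY finite group action**: at all but finitely many `w`, every action of a finite group on the localised model
over `Spec 𝒪_{F,(w)}` has a stable affine cover (projectivity + [SGA1] V Prop. 1.8). [cite: SGA1, Exp. V, Prop. 1.8] -/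
theorem eventually_forall_exists_stableAffineOpen (hX : IsProjectiveOver X) :
    ∀ᶠ w : HeightOneSpectrum (𝓞 F) in cofinite, ∀ {H : Type} [Group H] [Finite H] (θ : ActionOver (𝒳.localise w).total.hom H),
      ∀ y : ↥(𝒳.localise w).total.left, ∃ O : θ.StableAffineOpens, y ∈ O.1 := by
  filter_upwards [eventually_isProjective_localise_thickening 𝒳 hX] with w hw
  intro H _ _ θ
  exact forall_exists_stableAffineOpen_over_of_isProjective _ hw θ

/-! ## §3 The head: the integral package of UP at cofinitely many primes -/

/-- **THE INTEGRAL PACKAGE OF THE GALOIS THICKENING (the GEO layer of the P6a letter UP).**  Data: a number field `F`; `X` smooth of relative dimension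
`1` and projective over `F`; a finite group `G` and `ρ : G →* Aut X`; a finite Galois extension `Fᵢ ∕ F` (`Γ := Fᵢ ≃ₐ[F] Fᵢ`); a global integral model
`𝒳` over `𝓞 F` of `Y := R_{Fᵢ} X` with quasi-compact, quasi-separated, locally finitely presented structure morphism; and the EQV-SPREAD
conclusion `hEQV` (the product action `τ = thickeningProdAction X ρ` extends to `𝒳.localise w` for cofinitely many `w`, in the literal shape of UP's
`_hθ`).  Conclusion: for all but finitely many `w`, `|G|` and `|Γ|` are units of `𝒪_{F,(w)}`, `𝒳.localise w` is smooth of relative dimension `1`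
and proper, and there is an action `θ` of `Γ × G` on it over `Spec 𝒪_{F,(w)}` with a stable affine cover and generic fibre `τ` — i.e. UP's
binders `(_hcard, _hcardΓ, h𝓨, θ, _hcovθ, _hθ)` at `𝓨 := 𝒳.localise w`; the generic binders `(Y, π, Γ, τ, _hτπ, _hτT, ℓ, _hℓ)` are ★
`thickeningπ`, `thickeningProdAction`, `isGeometricQuotient_inl_thickeningProdAction`, `thickeningProdAction_inr_comp_π`, `thickeningLift`,
`map_thickeningπ_thickeningLift`. [cite: SerreTate1968, §1] [cite: EGAIV3, Thm. 8.10.5] [cite: SGA1, Exp. V, Prop. 1.8] [cite: Neukirch1999, Ch. I §11] -/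
theorem exists_integralPackage_eventually [IsGalois F Fi] [SmoothOfRelativeDimension 1 X.hom] (hX : IsProjectiveOver X)
    {G : Type} [Group G] [Finite G] (ρ : G →* Aut X)
    (hEQV : ∀ᶠ w : HeightOneSpectrum (𝓞 F) in cofinite,
      ∃ θ : ActionOver (𝒳.localise w).total.hom ((Fi ≃ₐ[F] Fi) × G), ∀ a : (Fi ≃ₐ[F] Fi) × G,
        (genericFibre (valuationSubringAtPrime F w) F).map (Over.isoMk (θ.aut a) (θ.aut_comp a)).hom ≫ (𝒳.localise w).genericIso'.hom
          = (𝒳.localise w).genericIso'.hom ≫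
              (Over.isoMk ((thickeningProdAction X ρ).aut a) ((thickeningProdAction X ρ).aut_comp a)).hom) :
    ∀ᶠ w : HeightOneSpectrum (𝓞 F) in cofinite,
      IsUnit ((Nat.card G : ℕ) : valuationSubringAtPrime F w) ∧
      IsUnit ((Nat.card (Fi ≃ₐ[F] Fi) : ℕ) : valuationSubringAtPrime F w) ∧
      (𝒳.localise w).IsSmoothProper 1 ∧
      ∃ θ : ActionOver (𝒳.localise w).total.hom ((Fi ≃ₐ[F] Fi) × G),
        (∀ y : ↥(𝒳.localise w).total.left, ∃ O : θ.StableAffineOpens, y ∈ O.1) ∧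
        ∀ a : (Fi ≃ₐ[F] Fi) × G,
          (genericFibre (valuationSubringAtPrime F w) F).map (Over.isoMk (θ.aut a) (θ.aut_comp a)).hom ≫ (𝒳.localise w).genericIso'.hom
            = (𝒳.localise w).genericIso'.hom ≫
                (Over.isoMk ((thickeningProdAction X ρ).aut a) ((thickeningProdAction X ρ).aut_comp a)).hom := by
  filter_upwards [Literature.RingTheory.DedekindDomain.eventually_isUnit_natCard_valuationSubringAtPrime (𝓞 F) F G,
    Literature.RingTheory.DedekindDomain.eventually_isUnit_natCard_valuationSubringAtPrime (𝓞 F) F (Fi ≃ₐ[F] Fi),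
    eventually_isSmoothProper_localise_thickening 𝒳 hX, eventually_forall_exists_stableAffineOpen 𝒳 hX, hEQV]
    with w h1 h2 h3 h4 h5
  obtain ⟨θ, hθ⟩ := h5
  exact ⟨h1, h2, h3, θ, h4 θ, hθ⟩

end Literature.AlgebraicGeometry.Motives

end
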